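import Summits.QuantumFields.BalabanUV.Beta.FP.PeriodisedBorderTables
import Summits.QuantumFields.BalabanUV.Beta.FP.TorusGaugeCovariance
import Summits.QuantumFields.BalabanUV.Beta.GAN24.BorderGaugeLegContact
import Summits.QuantumFields.BalabanUV.Beta.DiagonalContact

/-!
# `BalabanUV.Beta.FP.PeriodisedBorderWardContact` — road «FP» for binder row D1, ROUTE T row **(T-ID)**, the FIRST-ORDER border-table row
# AT THE TORUS: **THE PERIODISED FIRST-ORDER BORDER TABLE AGAINST THE TORUS GAUGE MODES IS A CONTACT TERM** — for the insertion bond `b = (κ, u)` and the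
# multiplier row `(x, μ)`, `Σ_{(y,α)} perF M (dper M (V κ u)) ((x, inr μ), (y, inl α)) · tgrad M (y, inl α) s = ([s = u + e_κ]_M − [s = p₂(x, μ)]_M) · Σ'_m q κ (u + M∘m) x μ`
# (the fluctuation-leg pure-gauge law of the table, periodised); for an1's ROOTED border table `vhSAt (toSite r)` the second contact point
# `x + ρ + L·e_μ` is a block ROOT and the contact kernel is `(L^{d+1}·stepScale)⁻¹ ×` the torus averaging row `Q₁₀`: on the RESIDUAL (non-root) columns
# **`Q₁₁^{(κ,u)} · D₁ = [· = u + e_κ] · (L^{d+1}·stepScale d L j)⁻¹ · Q₁₀(·, (u, κ)) ≠ 0`** — the STATIC row `c1 : Q₁₁·[D₂|D₁] = 0` of the torus call is NOT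
# instantiable at the rooted table; the law is the MOVING-frame letter with an ultralocal generator jet (located finding F-d1leaf02g17-1)

HONEST DEPENDENCY (page 1, mandatory): continuum YM on T⁴ ⇐ BetaPertH ∧ nine spine estimates (0/9 proved); BetaPertH ⇐ (D1) ∧ (D4) ∧ CAP+tail;
G-an2-4 gates asym, D1 and NE2/3/4.  HONEST FRAMING (cell contract, verbatim): «discharging `BetaPertH` makes Bałaban's UV stability UNCONDITIONAL —
a real constructive-QFT result; it is NOT the continuum limit and NOT the Clay problem.»  ABSOLUTE RULE (cell charter, verbatim): «No internally-minted
statement may enter as a cited fact. Every hypothesis is either kernel-proved in this package or a verbatim quotation of a PUBLISHED theorem with page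
reference. The manuscript(s) under audit are NOT citable for their own disputed steps — they are the thing under adjudication; programme-internal
(2001/route/tribunal) claims are never citable.»  THIS MODULE is [folklore] re-indexing of finitely supported period sums over OUR typed objects: gan24-p3's
`perZ`∕`perF`∕`dper`, gan24-leaf-05's `tgrad`∕`tdelta`, gan24-leaf-02's fluctuation-leg law `GAN24.BorderGaugeLegContact.tsum_vhSAt_mul_dz` (for an1's `vhSAt`),
leaf-03's bridges `off_eq_zero_iff_proj` ∕ `linAvgAt_delta1_eq_pow_mul_linKerAt`; no `def`, no `def … : Prop`, nothing cited, 0 sorry; 0 estimates; 0∕4 row-D1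
binders; NOT (T-ID) complete (WHICH table the instance's `Q₁₁` periodises — the rooted comb `vhSAt (toSite r)` typed here, or the record's (0.4)-symmetrised
`symVhSAt ρ_c` whose law `GAN24.SymBorderGaugeLegContact.tsum_symVhSAt_mul_dz` has the same shape — and which object the literal's generator jet `W₁` IS, are
the dictionary's ∕ the OWNER's), NOT SDF, NOT D1, NOT BetaPertH, NOT continuum, NOT Clay.  «not in print; our bookkeeping».

WHY (located finding F-d1leaf02g17-1, journal 2026-08-22 [D1LEAF02-G17-F1]; OWNER d1-p3 g17 INTENT I-FP-17-8 `NestedStepLawTorusInstance` displays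
`c1 : Q₁₁ * fromCols D₂ D₁ = 0`; row-D1 owner an2 g36 R-D1-g36-1 (D) «the static rows are TABLE IDENTITIES to be checked … IF such a row fails, §5 is the
receptacle»).  This file CHECKS the order-1 row at the torus for the rooted table and finds the contact term, in the instance's own presentation
(`fν b = (b.1, inl b.2)`, multiplier rows `(x, inr μ)`, columns of `tgrad`).

CONTENT (generic `d`; box `M` with `M_i = N·M′_i`).
* §1 [folklore] **`sum_perZ_mul_tgrad`** — TORUS PAIRING = LATTICE PAIRING WITH THE PERIODIC INDICATOR: for a kernel `K` finitely supported in its fluctuation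
  slot, `Σ_{y ∈ pbox M} Σ_α perZ M K x y (inr μ) (inl α) · tgrad M (y, inl α) s = Σ'_z Σ_α K x z (inr μ) (inl α) · dz ψ_s α z`, `ψ_s := tdelta M · s`
  (`dz = grad`: an1's `AveragingContours.grad_eq_dz`).
* §2 [folklore] **`sum_perZ_dper_mul_tgrad_of_gaugeLeg`** — for a block-covariant table family `V` (letter (TV)), finitely supported in the fluctuation slot and in
  the family index (Finset-valued supports `S`, `T` as DATA), whose fluctuation-leg law holds with contact points `u + e_κ`, `p₂ x μ` and kernel `q` (also
  supported in `T`): the displayed torus contact formula; matrix form `submatrix_mul_tgrad_of_gaugeLeg` for multiplier slot maps `a ↦ (pμ a, inr (mμ a))`.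
* §3 THE ROOTED COMB TABLE `vhSAt (toSite r) d L` (`r ∈ box`, `1 ≤ L`): all §2 letters DISCHARGED (`vhSAt_translate`, `vhSAt_inr_inl_eq_zero_of_not_mem`,
  `vhKerAt_eq_zero_right`, `linKerAt_eq_zero`, `tsum_vhSAt_mul_dz`) — **`sum_perZ_dper_vhSAt_mul_tgrad`**; the contact kernel against the torus averaging
  rows: `bhKAt_inr_inl_eq_pow_mul_linSymAt` (`bhKAt = L^{d+1}·linSymAt` on the `(inr, inl)` block), **`tsum_linSymAt_translate_eq`**
  (`Σ'_m q = (L^{d+1}·stepScale d L j)⁻¹ · perZ M (bhKStepAt d (toSite r) L j) x u (inr μ) (inl κ)`); the second contact point is a ROOT: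
  `tdelta_far_eq_zero_of_not_root`; hence **`sum_perZ_dper_vhSAt_mul_tgrad_of_not_root`** — on a non-root column `s` the pairing is
  `tdelta M (u + e_κ) s · (L^{d+1}·stepScale)⁻¹ · perZ M (bhKStepAt …) x u (inr μ) (inl κ)`: the TIP CONTACT, nonzero; matrix form in the torus call's
  presentation **`submatrix_vhSAt_mul_tgrad_of_not_root`** (`(Q₁₁^{(κ,u)} * D₁) a c = tdelta M (u + e_κ) (g c) · (L^{d+1}·stepScale)⁻¹ · Q₁₀ a (u, κ)`)
  and, for ALL columns (both contact points — the block-constant `D₂` columns are finite sums of these), `submatrix_vhSAt_mul_tgrad`.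
NOT HERE: the (0.4)-symmetrised table (same proof with `tsum_symVhSAt_mul_dz`; on request), the second-order row `c2` (needs the two-insertion law of
`vh₂S`, not in the tree), the naming of `W₁`∕`D̄₁` in p308750's shape (the OWNER's v2), any estimate.
Provenance: D1 formalisation swarm LEAF PROVER 02, unit b2b-balaban-beta-d1-formalise-leaf-02 gen 17, 2026-08-22.  No existing file touched.
-/

noncomputable section

open scoped BigOperators

namespace Summit.QuantumFields.BalabanUV.Beta.FP.PeriodisedBorderWardContact

open Finset
open Literature.Probability.LatticeModels (Torus.proj Torus.proj_apply)
open Literature.MathematicalPhysics.QuantumFieldTheory.Balaban1983to89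
open Literature.MathematicalPhysics.QuantumFieldTheory.Balaban1983to89.Beta
open B4TorusKernel.MultiPeriod (translate translate_apply)
open B6Lemma24Torus (pbox mem_pbox)
open ExpKernelCalculus (MKer shiftK)
open AffineAveraging (Site box toSite unitVec dz)
open AveragingContours (off blk grad grad_eq_dz)
open AveragingHessianKernelsRooted (vhSAt vhSAt_translate vhKerAt_eq_zero_right linKerAt linKerAt_eq_zero)
open AveragingHessianKernels (packVH_inr_inl)
open OneStepResolventKernel (Fib)
open Summit.QuantumFields.BalabanUV.Beta.BorderedHessian (bhKAt bhKAt_inr_inl bhKStepAt stepScale stepScale_ne_zero off_eq_zero_iff_proj blk_eq_quo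
  linAvgAt_delta1_eq_pow_mul_linKerAt)
open Summit.QuantumFields.BalabanUV.Beta.AveragingWardRootedStencils (linSymAt linSymAt_inr_inl)
open Summit.QuantumFields.BalabanUV.Beta.GAN24.BorderGaugeLegContact (tsum_vhSAt_mul_dz vhSAt_inr_inl_eq_zero_of_not_mem)
open Summit.QuantumFields.BalabanUV.Beta.FP.KernelPeriodisationFib (Idx perF perF_apply perZ perZ_apply)
open Summit.QuantumFields.BalabanUV.Beta.FP.KernelPeriodisationFibLoc (dper)
open Summit.QuantumFields.BalabanUV.Beta.FP.KernelPeriodisationFibTrace (tsum_sites_eq_sum_tsum)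
open Summit.QuantumFields.BalabanUV.Beta.FP.PeriodisedBorderTables (dper_apply_of_blockCov)
open Summit.QuantumFields.BalabanUV.Beta.FP.TorusGaugeCovariance (tdelta tdelta_translate tgrad tgrad_inl_eq_grad grad_tdelta_translate nearBox mem_nearBox
  tdelta_eq_zero_of_root bhKStepAt_inr)

variable {d : ℕ}

/-! ## §1 Torus pairing = lattice pairing with the periodic indicator -/

section Pairing

variable (M : Fin (d + 1) → ℕ) [∀ μ, NeZero (M μ)]

/-- [folklore] **`sum_perZ_mul_tgrad` — THE TORUS PAIRING IS THE LATTICE PAIRING WITH THE PERIODIC INDICATOR**: for a kernel `K` whose `(inr μ, inl α)` entries are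
finitely supported in the fluctuation (second) slot for the given first slot `x`,
`Σ_{y ∈ pbox M} Σ_α perZ M K x y (inr μ) (inl α) · tgrad M (y, inl α) s = Σ'_z Σ_α K x z (inr μ) (inl α) · dz (tdelta M · s) α z`. -/
theorem sum_perZ_mul_tgrad (K : MKer (d + 1) (Fib d)) (x : Site (d + 1)) (μ : Fin (d + 1)) (s : ↥(pbox M))
    (hK : ∀ (α : Fin (d + 1)) (g : Site (d + 1) → ℝ), Summable fun z => K x z (Sum.inr μ) (Sum.inl α) * g z) :
    ∑ y : ↥(pbox M), ∑ α : Fin (d + 1), perZ M K x (y : Site (d + 1)) (Sum.inr μ) (Sum.inl α) * tgrad M (y, Sum.inl α) s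
      = ∑' z : Site (d + 1), ∑ α : Fin (d + 1), K x z (Sum.inr μ) (Sum.inl α) * dz (fun w => tdelta M w s) α z := by
  set H : Fin (d + 1) → Site (d + 1) → ℝ := fun α z => K x z (Sum.inr μ) (Sum.inl α) * dz (fun w => tdelta M w s) α z with hH
  have hHs : ∀ α, Summable (H α) := fun α => hK α _
  have hterm : ∀ (y : ↥(pbox M)) (α : Fin (d + 1)),
      perZ M K x (y : Site (d + 1)) (Sum.inr μ) (Sum.inl α) * tgrad M (y, Sum.inl α) s
        = ∑' m : Site (d + 1), H α (translate M (y : Site (d + 1)) m) := fun y α => by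
    rw [perZ_apply, ← tsum_mul_right]
    refine tsum_congr fun m => ?_
    simp only [hH, ← grad_eq_dz, tgrad_inl_eq_grad, grad_tdelta_translate]
  calc ∑ y : ↥(pbox M), ∑ α : Fin (d + 1), perZ M K x (y : Site (d + 1)) (Sum.inr μ) (Sum.inl α) * tgrad M (y, Sum.inl α) s
      = ∑ y : ↥(pbox M), ∑ α : Fin (d + 1), ∑' m : Site (d + 1), H α (translate M (y : Site (d + 1)) m) :=
        Finset.sum_congr rfl fun y _ => Finset.sum_congr rfl fun α _ => hterm y α
    _ = ∑ α : Fin (d + 1), ∑ y : ↥(pbox M), ∑' m : Site (d + 1), H α (translate M (y : Site (d + 1)) m) := Finset.sum_comm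
    _ = ∑ α : Fin (d + 1), ∑' z : Site (d + 1), H α z := Finset.sum_congr rfl fun α _ => (tsum_sites_eq_sum_tsum M (hHs α)).symm
    _ = ∑' z : Site (d + 1), ∑ α : Fin (d + 1), H α z := (Summable.tsum_finsetSum fun α _ => hHs α).symm

end Pairing

/-! ## §2 A block-covariant, finitely supported table family with a fluctuation-leg contact law, periodised -/

section Generic

variable {M M' : Fin (d + 1) → ℕ} [∀ μ, NeZero (M μ)] {N : ℕ}
  (V : Fin (d + 1) → Site (d + 1) → MKer (d + 1) (Fib d)) (q : Fin (d + 1) → Site (d + 1) → Site (d + 1) → Fin (d + 1) → ℝ)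
  (p₂ : Site (d + 1) → Fin (d + 1) → Site (d + 1)) (S T : Site (d + 1) → Finset (Site (d + 1)))

/-- [folklore] **`sum_perZ_dper_mul_tgrad_of_gaugeLeg` — THE FLUCTUATION-LEG CONTACT LAW, PERIODISED.**  Letters: `hM` the period shape; (TV) block covariance of
`V` at blocking `N`; `hS` finite support of the `(inr, inl)` entries in the fluctuation slot (`z ∉ S x ⇒ 0`); `hT` finite support in the family index for a fixed
multiplier site (`u ∉ T x ⇒ 0`) and `hqT` the same for the contact kernel `q`; `hlaw` the `dψ`-form of the law with contact points `u + e_κ`, `p₂ x μ`.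
Conclusion: the torus pairing of the periodised table with a torus gauge-mode column is
`(tdelta M (u + e_κ) s − tdelta M (p₂ x μ) s) · Σ'_m q κ (u + M∘m) x μ`. -/
theorem sum_perZ_dper_mul_tgrad_of_gaugeLeg (hM : ∀ i, M i = N * M' i)
    (hVt : ∀ (κ : Fin (d + 1)) (u t : Site (d + 1)), V κ (u + (N : ℤ) • t) = shiftK (-((N : ℤ) • t)) (V κ u))
    (hS : ∀ (κ : Fin (d + 1)) (u x : Site (d + 1)) (μ α : Fin (d + 1)), ∀ z ∉ S x, V κ u x z (Sum.inr μ) (Sum.inl α) = 0)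
    (hT : ∀ (κ : Fin (d + 1)) (x z : Site (d + 1)) (μ α : Fin (d + 1)), ∀ u ∉ T x, V κ u x z (Sum.inr μ) (Sum.inl α) = 0)
    (hqT : ∀ (κ : Fin (d + 1)) (x : Site (d + 1)) (μ : Fin (d + 1)), ∀ u ∉ T x, q κ u x μ = 0)
    (hlaw : ∀ (κ : Fin (d + 1)) (u x : Site (d + 1)) (μ : Fin (d + 1)) (ψ : Site (d + 1) → ℝ),
      ∑' z, ∑ α, V κ u x z (Sum.inr μ) (Sum.inl α) * dz ψ α z = (ψ (u + unitVec κ) - ψ (p₂ x μ)) * q κ u x μ)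
    (κ : Fin (d + 1)) (u x : Site (d + 1)) (μ : Fin (d + 1)) (s : ↥(pbox M)) :
    ∑ y : ↥(pbox M), ∑ α : Fin (d + 1), perZ M (dper M (V κ u)) x (y : Site (d + 1)) (Sum.inr μ) (Sum.inl α) * tgrad M (y, Sum.inl α) s
      = (tdelta M (u + unitVec κ) s - tdelta M (p₂ x μ) s) * ∑' m : Site (d + 1), q κ (translate M u m) x μ := by
  -- the copies of the insertion bond that load the multiplier site `x` are finitely many
  have hinj : Function.Injective fun m : Site (d + 1) => translate M u m := by
    intro m m' h
    funext i
    have hi := congrFun h i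
    simp only [translate_apply] at hi
    have hMi : (M i : ℤ) ≠ 0 := by exact_mod_cast NeZero.ne (M i)
    exact mul_left_cancel₀ hMi (by linarith)
  set F : Finset (Site (d + 1)) := (T x).preimage (fun m => translate M u m) hinj.injOn with hF
  have hF' : ∀ m ∉ F, translate M u m ∉ T x := fun m hm ht => hm (Finset.mem_preimage.2 ht)
  -- the periodised table, entrywise, as a FINITE sum over those copies
  have hdper : ∀ (z : Site (d + 1)) (α : Fin (d + 1)),
      dper M (V κ u) x z (Sum.inr μ) (Sum.inl α) = ∑ m ∈ F, V κ (translate M u m) x z (Sum.inr μ) (Sum.inl α) := fun z α => by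
    rw [dper_apply_of_blockCov hM hVt κ u x z]
    exact tsum_eq_sum fun m hm => hT κ x z μ α _ (hF' m hm)
  -- finite support in the fluctuation slot ⇒ §1 applies to `K := dper M (V κ u)`
  have hK : ∀ (α : Fin (d + 1)) (g : Site (d + 1) → ℝ), Summable fun z => dper M (V κ u) x z (Sum.inr μ) (Sum.inl α) * g z := by
    intro α g
    refine summable_of_ne_finset_zero (s := S x) fun z hz => ?_
    rw [hdper, Finset.sum_eq_zero fun m _ => hS κ _ x μ α z hz, zero_mul]
  rw [sum_perZ_mul_tgrad M (dper M (V κ u)) x μ s hK]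
  -- swap the lattice sum with the finite sum over copies, apply the law copy by copy
  have hswap : ∑' z : Site (d + 1), ∑ α : Fin (d + 1), dper M (V κ u) x z (Sum.inr μ) (Sum.inl α) * dz (fun w => tdelta M w s) α z
      = ∑ m ∈ F, ∑' z : Site (d + 1), ∑ α : Fin (d + 1), V κ (translate M u m) x z (Sum.inr μ) (Sum.inl α) * dz (fun w => tdelta M w s) α z := by
    have hsm : ∀ m ∈ F, Summable fun z => ∑ α : Fin (d + 1), V κ (translate M u m) x z (Sum.inr μ) (Sum.inl α) * dz (fun w => tdelta M w s) α z :=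
      fun m _ => summable_of_ne_finset_zero (s := S x) fun z hz => Finset.sum_eq_zero fun α _ => by rw [hS κ _ x μ α z hz, zero_mul]
    rw [← Summable.tsum_finsetSum hsm]
    refine tsum_congr fun z => ?_
    rw [Finset.sum_comm]
    refine Finset.sum_congr rfl fun α _ => ?_
    rw [hdper z α, Finset.sum_mul]
  rw [hswap]
  have hcopy : ∀ m ∈ F, ∑' z : Site (d + 1), ∑ α : Fin (d + 1), V κ (translate M u m) x z (Sum.inr μ) (Sum.inl α) * dz (fun w => tdelta M w s) α z
      = (tdelta M (u + unitVec κ) s - tdelta M (p₂ x μ) s) * q κ (translate M u m) x μ := fun m _ => by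
    rw [hlaw κ (translate M u m) x μ (fun w => tdelta M w s)]
    congr 2
    rw [show translate M u m + unitVec κ = translate M (u + unitVec κ) m by funext i; simp only [translate_apply, Pi.add_apply]; ring]
    exact tdelta_translate M _ m s
  rw [Finset.sum_congr rfl hcopy, ← Finset.mul_sum, tsum_eq_sum fun m hm => hqT κ x μ _ (hF' m hm)]

/-- [folklore] **MATRIX FORM AT SLOT MAPS**: field slots presented by ALL of them, `fν b = (b.1, inl b.2)`; multiplier slots by any map `a ↦ (pμ a, inr (mμ a))`;
columns of `tgrad` read through any `g`.  Then `(perF M (dper M (V κ u))∘(fμ,fν) * tgrad∘(fν,g)) a c` is the displayed contact term. -/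
theorem submatrix_mul_tgrad_of_gaugeLeg (hM : ∀ i, M i = N * M' i)
    (hVt : ∀ (κ : Fin (d + 1)) (u t : Site (d + 1)), V κ (u + (N : ℤ) • t) = shiftK (-((N : ℤ) • t)) (V κ u))
    (hS : ∀ (κ : Fin (d + 1)) (u x : Site (d + 1)) (μ α : Fin (d + 1)), ∀ z ∉ S x, V κ u x z (Sum.inr μ) (Sum.inl α) = 0)
    (hT : ∀ (κ : Fin (d + 1)) (x z : Site (d + 1)) (μ α : Fin (d + 1)), ∀ u ∉ T x, V κ u x z (Sum.inr μ) (Sum.inl α) = 0)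
    (hqT : ∀ (κ : Fin (d + 1)) (x : Site (d + 1)) (μ : Fin (d + 1)), ∀ u ∉ T x, q κ u x μ = 0)
    (hlaw : ∀ (κ : Fin (d + 1)) (u x : Site (d + 1)) (μ : Fin (d + 1)) (ψ : Site (d + 1) → ℝ),
      ∑' z, ∑ α, V κ u x z (Sum.inr μ) (Sum.inl α) * dz ψ α z = (ψ (u + unitVec κ) - ψ (p₂ x μ)) * q κ u x μ)
    {μI γ : Type*} (pμ : μI → Site (d + 1)) (hpμ : ∀ a, pμ a ∈ pbox M) (mμ : μI → Fin (d + 1)) (g : γ → ↥(pbox M))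
    (κ : Fin (d + 1)) (u : Site (d + 1)) (a : μI) (c : γ) :
    ((perF M (dper M (V κ u))).submatrix (fun a : μI => ((⟨pμ a, hpμ a⟩, Sum.inr (mμ a)) : Idx M (Fib d)))
          (fun b : ↥(pbox M) × Fin (d + 1) => ((b.1, Sum.inl b.2) : Idx M (Fib d)))
        * (tgrad M).submatrix (fun b : ↥(pbox M) × Fin (d + 1) => ((b.1, Sum.inl b.2) : Idx M (Fib d))) g) a c
      = (tdelta M (u + unitVec κ) (g c) - tdelta M (p₂ (pμ a) (mμ a)) (g c)) * ∑' m : Site (d + 1), q κ (translate M u m) (pμ a) (mμ a) := by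
  rw [Matrix.mul_apply, Fintype.sum_prod_type]
  simp only [Matrix.submatrix_apply, perF_apply]
  exact sum_perZ_dper_mul_tgrad_of_gaugeLeg V q p₂ S T hM hVt hS hT hqT hlaw κ u (pμ a) (mμ a) (g c)

end Generic

/-! ## §3 The rooted comb table `vhSAt (toSite r) d L`: letters discharged; the contact kernel against the torus averaging rows -/

section Rooted

variable {M M' : Fin (d + 1) → ℕ} [∀ μ, NeZero (M μ)] {L : ℕ} [NeZero L] {r : Fin (d + 1) → ℕ}

omit [NeZero L] in
/-- [folklore] family-index support of the `(inr, inl)` entries of `vhSAt (toSite r)`: the background bond's base lies in the support box of the block of the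
multiplier site (`vhKerAt_eq_zero_right` through the packer). -/
theorem vhSAt_inr_inl_eq_zero_of_not_mem_family (hr : r ∈ box (d + 1) L) (κ : Fin (d + 1)) (x z : Site (d + 1)) (μ α : Fin (d + 1))
    {u : Site (d + 1)} (hu : u ∉ nearBox L (blk L x)) : vhSAt (toSite r) d L rfl κ u x z (Sum.inr μ) (Sum.inl α) = 0 := by
  rw [mem_nearBox] at hu
  simp only [vhSAt, packVH_inr_inl]
  split_ifs
  · exact vhKerAt_eq_zero_right hr _ (f' := (κ, u)) hu
  · rfl

omit [NeZero L] in
/-- [folklore] family-index support of the rooted packed first-order kernel's `(inr, inl)` entry (`linKerAt_eq_zero`). -/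
theorem linSymAt_inr_inl_eq_zero_of_not_mem_family (hr : r ∈ box (d + 1) L) (κ : Fin (d + 1)) (x : Site (d + 1)) (μ : Fin (d + 1))
    {u : Site (d + 1)} (hu : u ∉ nearBox L (blk L x)) : linSymAt (toSite r) L x u (Sum.inr μ) (Sum.inl κ) = 0 := by
  rw [mem_nearBox] at hu
  rw [linSymAt_inr_inl]
  split_ifs
  · exact linKerAt_eq_zero hr (f := (κ, u)) hu
  · rfl

/-- [folklore] **`sum_perZ_dper_vhSAt_mul_tgrad` — THE ROOTED BORDER TABLE, PERIODISED, AGAINST A TORUS GAUGE-MODE COLUMN IS A CONTACT TERM**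
(`M = L·M′`, `r ∈ box`): for the insertion bond `(κ, u)`, the multiplier row `(x, μ)` and any column `s`,
`Σ_y Σ_α perZ M (dper M (vhSAt ρ κ u)) x y (inr μ) (inl α) · tgrad M (y, inl α) s = (tdelta M (u + e_κ) s − tdelta M (x + ρ + L•e_μ) s) · Σ'_m linSymAt ρ L x (u + M∘m) (inr μ) (inl κ)`. -/
theorem sum_perZ_dper_vhSAt_mul_tgrad (hM : ∀ i, M i = L * M' i) (hr : r ∈ box (d + 1) L)
    (κ : Fin (d + 1)) (u x : Site (d + 1)) (μ : Fin (d + 1)) (s : ↥(pbox M)) :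
    ∑ y : ↥(pbox M), ∑ α : Fin (d + 1), perZ M (dper M (vhSAt (toSite r) d L rfl κ u)) x (y : Site (d + 1)) (Sum.inr μ) (Sum.inl α) * tgrad M (y, Sum.inl α) s
      = (tdelta M (u + unitVec κ) s - tdelta M (x + toSite r + (L : ℤ) • unitVec μ) s)
        * ∑' m : Site (d + 1), linSymAt (toSite r) L x (translate M u m) (Sum.inr μ) (Sum.inl κ) := by
  have hL : 1 ≤ L := Nat.one_le_iff_ne_zero.mpr (NeZero.ne L)
  exact sum_perZ_dper_mul_tgrad_of_gaugeLeg (vhSAt (toSite r) d L rfl) (fun κ u x μ => linSymAt (toSite r) L x u (Sum.inr μ) (Sum.inl κ))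
    (fun x μ => x + toSite r + (L : ℤ) • unitVec μ) (fun x => nearBox L (blk L x)) (fun x => nearBox L (blk L x)) hM
    (fun κ u t => vhSAt_translate (toSite r) hL κ u t)
    (fun κ u x μ α z hz => vhSAt_inr_inl_eq_zero_of_not_mem hr κ u x μ α hz)
    (fun κ x z μ α u hu => vhSAt_inr_inl_eq_zero_of_not_mem_family hr κ x z μ α hu)
    (fun κ x μ u hu => linSymAt_inr_inl_eq_zero_of_not_mem_family hr κ x μ hu)
    (fun κ u x μ ψ => tsum_vhSAt_mul_dz hL hr κ u x μ ψ) κ u x μ s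

/-- [folklore] **THE TORUS AVERAGING ROW IS `L^{d+1}` TIMES THE ROOTED PACKED FIRST-ORDER KERNEL** on the `(inr μ, inl κ)` block:
`bhKAt d ρ L x u (inr μ) (inl κ) = L^{d+1} · linSymAt ρ L x u (inr μ) (inl κ)` (bridges `off_eq_zero_iff_proj`, `blk_eq_quo`, `linAvgAt_delta1_eq_pow_mul_linKerAt`). -/
theorem bhKAt_inr_inl_eq_pow_mul_linSymAt (ρ : Site (d + 1)) (x u : Site (d + 1)) (μ κ : Fin (d + 1)) :
    bhKAt d ρ L x u (Sum.inr μ) (Sum.inl κ) = (L : ℝ) ^ (d + 1) * linSymAt ρ L x u (Sum.inr μ) (Sum.inl κ) := by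
  rw [bhKAt_inr_inl, linSymAt_inr_inl]
  by_cases hx : off L x = 0
  · rw [if_pos ((off_eq_zero_iff_proj x).1 hx), if_pos hx, linAvgAt_delta1_eq_pow_mul_linKerAt, blk_eq_quo]
  · have hx' : ¬ Torus.proj L x = 0 := fun h => hx ((off_eq_zero_iff_proj x).2 h)
    rw [if_neg hx', if_neg hx, mul_zero]

omit [∀ μ, NeZero (M μ)] in
/-- [folklore] **THE CONTACT KERNEL IS THE TORUS AVERAGING ROW OF THE INSERTION BOND**:
`Σ'_m linSymAt ρ L x (u + M∘m) (inr μ) (inl κ) = (L^{d+1} · stepScale d L j)⁻¹ · perZ M (bhKStepAt d ρ L j) x u (inr μ) (inl κ)` — i.e. `(L^{d+1}·stepScale)⁻¹ ×` the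
entry `Q₁₀((x, inr μ), (u, inl κ))` of the torus call's averaging rows. -/
theorem tsum_linSymAt_translate_eq (ρ : Site (d + 1)) (j : ℕ) (x u : Site (d + 1)) (μ κ : Fin (d + 1)) :
    ∑' m : Site (d + 1), linSymAt ρ L x (translate M u m) (Sum.inr μ) (Sum.inl κ)
      = ((L : ℝ) ^ (d + 1) * stepScale d L j)⁻¹ * perZ M (bhKStepAt d ρ L j) x u (Sum.inr μ) (Sum.inl κ) := by
  have hL : (L : ℝ) ^ (d + 1) ≠ 0 := pow_ne_zero _ (by exact_mod_cast NeZero.ne L)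
  have hsc : stepScale d L j ≠ 0 := stepScale_ne_zero (d := d) (Lc := L) j
  have hent : ∀ m : Site (d + 1), linSymAt ρ L x (translate M u m) (Sum.inr μ) (Sum.inl κ)
      = ((L : ℝ) ^ (d + 1) * stepScale d L j)⁻¹ * bhKStepAt d ρ L j x (translate M u m) (Sum.inr μ) (Sum.inl κ) := fun m => by
    rw [bhKStepAt_inr, bhKAt_inr_inl_eq_pow_mul_linSymAt]
    field_simp
  rw [tsum_congr hent, tsum_mul_left, perZ_apply]

omit [∀ μ, NeZero (M μ)] [NeZero L] in
/-- [folklore] **THE FAR CONTACT POINT IS A BLOCK ROOT**: for a multiplier site on the coarse sublattice (`proj L x = 0`), a box with `L ∣ M_i` and a NON-ROOT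
column `s` (`proj L (s − ρ) ≠ 0`), `tdelta M (x + ρ + L•e_μ) s = 0`. -/
theorem tdelta_far_eq_zero_of_not_root (hM : ∀ i, L ∣ M i) (ρ : Site (d + 1)) {x : Site (d + 1)} (hx : Torus.proj L x = 0) (μ : Fin (d + 1))
    {s : ↥(pbox M)} (hs : Torus.proj L ((s : Site (d + 1)) - ρ) ≠ 0) : tdelta M (x + ρ + (L : ℤ) • unitVec μ) s = 0 := by
  refine tdelta_eq_zero_of_root M hM ?_ hs
  have e : x + ρ + (L : ℤ) • unitVec μ - ρ = x + (L : ℤ) • unitVec μ := by abel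
  rw [e]
  funext i
  have hxi := congrFun hx i
  simp only [Torus.proj_apply, Pi.zero_apply] at hxi ⊢
  simp only [Pi.add_apply, Pi.smul_apply, smul_eq_mul, Int.cast_add, Int.cast_mul, Int.cast_natCast, ZMod.natCast_self, zero_mul, add_zero, hxi]

omit [∀ μ, NeZero (M μ)] in
/-- [folklore] off the coarse sublattice the multiplier row of the periodised step kernel vanishes (so the contact kernel does too). -/
theorem perZ_bhKStepAt_inr_inl_of_proj_ne (ρ : Site (d + 1)) (j : ℕ) {x : Site (d + 1)} (hx : Torus.proj L x ≠ 0) (u : Site (d + 1)) (μ κ : Fin (d + 1)) :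
    perZ M (bhKStepAt d ρ L j) x u (Sum.inr μ) (Sum.inl κ) = 0 := by
  rw [perZ_apply]
  refine (tsum_congr fun m => ?_).trans tsum_zero
  rw [bhKStepAt_inr, bhKAt_inr_inl, if_neg hx, mul_zero]

/-- [folklore] **`sum_perZ_dper_vhSAt_mul_tgrad_of_not_root` — ON A RESIDUAL (NON-ROOT) COLUMN ONLY THE TIP CONTACT SURVIVES**:
`Σ_y Σ_α perZ M (dper M (vhSAt ρ κ u)) x y (inr μ) (inl α) · tgrad M (y, inl α) s = tdelta M (u + e_κ) s · (L^{d+1}·stepScale d L j)⁻¹ · perZ M (bhKStepAt d ρ L j) x u (inr μ) (inl κ)`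
for `ρ = toSite r`, `r ∈ box`, `M = L·M′`, `proj L (s − ρ) ≠ 0` — in the torus call's letters: `(Q₁₁^{(κ,u)} · D₁)(a, s) = [s = u + e_κ] · (L^{d+1}·stepScale)⁻¹ · Q₁₀(a, (u, κ))`,
NOT zero. -/
theorem sum_perZ_dper_vhSAt_mul_tgrad_of_not_root (hM : ∀ i, M i = L * M' i) (hr : r ∈ box (d + 1) L) (j : ℕ)
    (κ : Fin (d + 1)) (u x : Site (d + 1)) (μ : Fin (d + 1)) {s : ↥(pbox M)} (hs : Torus.proj L ((s : Site (d + 1)) - toSite r) ≠ 0) :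
    ∑ y : ↥(pbox M), ∑ α : Fin (d + 1), perZ M (dper M (vhSAt (toSite r) d L rfl κ u)) x (y : Site (d + 1)) (Sum.inr μ) (Sum.inl α) * tgrad M (y, Sum.inl α) s
      = tdelta M (u + unitVec κ) s * (((L : ℝ) ^ (d + 1) * stepScale d L j)⁻¹ * perZ M (bhKStepAt d (toSite r) L j) x u (Sum.inr μ) (Sum.inl κ)) := by
  have hM' : ∀ i, L ∣ M i := fun i => ⟨M' i, hM i⟩
  rw [sum_perZ_dper_vhSAt_mul_tgrad hM hr κ u x μ s, tsum_linSymAt_translate_eq (M := M) (toSite r) j x u μ κ]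
  by_cases hx : Torus.proj L x = 0
  · rw [tdelta_far_eq_zero_of_not_root hM' (toSite r) hx μ hs, sub_zero]
  · rw [perZ_bhKStepAt_inr_inl_of_proj_ne (M := M) (toSite r) j hx, mul_zero, mul_zero, mul_zero]

/-- [folklore] **MATRIX FORM IN THE TORUS CALL's PRESENTATION** (field slots `fν b = (b.1, inl b.2)`, multiplier slots `a ↦ (pμ a, inr (mμ a))`, gauge-mode columns
read through any `g` landing in NON-ROOT box points — the residual parameters; the insertion bond a TORUS bond `(κ, u)`, `u ∈ pbox M`):
`(Q₁₁^{(κ,u)} * D₁) a c = tdelta M (u + e_κ) (g c) · (L^{d+1}·stepScale d L j)⁻¹ · Q₁₀ a (u, κ)` with `Q₁₁^{(κ,u)} := perF M (dper M (vhSAt ρ κ u))∘(fμ,fν)`,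
`D₁ := tgrad M∘(fν, g)`, `Q₁₀ := perF M (bhKStepAt d ρ L j)∘(fμ,fν)` — THE TIP CONTACT: row (i) order 1 of the torus call is NOT `= 0` at the rooted table. -/
theorem submatrix_vhSAt_mul_tgrad_of_not_root (hM : ∀ i, M i = L * M' i) (hr : r ∈ box (d + 1) L) (j : ℕ)
    {μI γ : Type*} (pμ : μI → Site (d + 1)) (hpμ : ∀ a, pμ a ∈ pbox M) (mμ : μI → Fin (d + 1)) (g : γ → ↥(pbox M))
    (hg : ∀ c, Torus.proj L ((g c : Site (d + 1)) - toSite r) ≠ 0) (κ : Fin (d + 1)) (u : ↥(pbox M)) (a : μI) (c : γ) :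
    ((perF M (dper M (vhSAt (toSite r) d L rfl κ (u : Site (d + 1))))).submatrix (fun a : μI => ((⟨pμ a, hpμ a⟩, Sum.inr (mμ a)) : Idx M (Fib d)))
          (fun b : ↥(pbox M) × Fin (d + 1) => ((b.1, Sum.inl b.2) : Idx M (Fib d)))
        * (tgrad M).submatrix (fun b : ↥(pbox M) × Fin (d + 1) => ((b.1, Sum.inl b.2) : Idx M (Fib d))) g) a c
      = tdelta M ((u : Site (d + 1)) + unitVec κ) (g c)
        * ((((L : ℝ) ^ (d + 1) * stepScale d L j)⁻¹)
          * (perF M (bhKStepAt d (toSite r) L j)).submatrix (fun a : μI => ((⟨pμ a, hpμ a⟩, Sum.inr (mμ a)) : Idx M (Fib d)))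
              (fun b : ↥(pbox M) × Fin (d + 1) => ((b.1, Sum.inl b.2) : Idx M (Fib d))) a (u, κ)) := by
  rw [Matrix.mul_apply, Fintype.sum_prod_type]
  simp only [Matrix.submatrix_apply, perF_apply]
  exact sum_perZ_dper_vhSAt_mul_tgrad_of_not_root hM hr j κ (u : Site (d + 1)) (pμ a) (mμ a) (hg c)

/-- [folklore] **MATRIX FORM, ALL COLUMNS** (both contact points displayed): with the slot maps of `submatrix_vhSAt_mul_tgrad_of_not_root` but ANY column map `g`,
`(Q₁₁^{(κ,u)} * tgrad∘(fν,g)) a c = (tdelta M (u + e_κ) (g c) − tdelta M (pμ a + ρ + L•e_{mμ a}) (g c)) · (L^{d+1}·stepScale d L j)⁻¹ · Q₁₀ a (u, κ)` — the block-constant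
(`D₂`) columns of the torus call are finite sums of these (`TorusGaugeCovarianceCoarse.tgradBlock_eq_sum_tgrad_mul`). -/
theorem submatrix_vhSAt_mul_tgrad (hM : ∀ i, M i = L * M' i) (hr : r ∈ box (d + 1) L) (j : ℕ)
    {μI γ : Type*} (pμ : μI → Site (d + 1)) (hpμ : ∀ a, pμ a ∈ pbox M) (mμ : μI → Fin (d + 1)) (g : γ → ↥(pbox M))
    (κ : Fin (d + 1)) (u : ↥(pbox M)) (a : μI) (c : γ) :
    ((perF M (dper M (vhSAt (toSite r) d L rfl κ (u : Site (d + 1))))).submatrix (fun a : μI => ((⟨pμ a, hpμ a⟩, Sum.inr (mμ a)) : Idx M (Fib d)))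
          (fun b : ↥(pbox M) × Fin (d + 1) => ((b.1, Sum.inl b.2) : Idx M (Fib d)))
        * (tgrad M).submatrix (fun b : ↥(pbox M) × Fin (d + 1) => ((b.1, Sum.inl b.2) : Idx M (Fib d))) g) a c
      = (tdelta M ((u : Site (d + 1)) + unitVec κ) (g c) - tdelta M (pμ a + toSite r + (L : ℤ) • unitVec (mμ a)) (g c))
        * ((((L : ℝ) ^ (d + 1) * stepScale d L j)⁻¹)
          * (perF M (bhKStepAt d (toSite r) L j)).submatrix (fun a : μI => ((⟨pμ a, hpμ a⟩, Sum.inr (mμ a)) : Idx M (Fib d)))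
              (fun b : ↥(pbox M) × Fin (d + 1) => ((b.1, Sum.inl b.2) : Idx M (Fib d))) a (u, κ)) := by
  rw [Matrix.mul_apply, Fintype.sum_prod_type]
  simp only [Matrix.submatrix_apply, perF_apply]
  rw [sum_perZ_dper_vhSAt_mul_tgrad hM hr κ (u : Site (d + 1)) (pμ a) (mμ a) (g c), tsum_linSymAt_translate_eq (M := M) (toSite r) j (pμ a) u (mμ a) κ]

end Rooted

end Summit.QuantumFields.BalabanUV.Beta.FP.PeriodisedBorderWardContact

end
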